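import Literature.Barriers.CriticalPhenomena.PlaquetteWalkHoleRootColumnLawWitness
import Literature.Barriers.CriticalPhenomena.PlaquetteWalkHoleRootMirrorZeros
import Literature.Barriers.CriticalPhenomena.PlaquetteWalkHoleRootWoundStraddle
import HarnessLib

/-!
# Barrier catalogue (SAWScalingLimit): the COLUMN LAW BELOW THE ROOT ROW, by the row mirror («COLUMN LAW BELOW»)

`Z → ∞` limit model of the printed Yang–Baxter weights [GlazmanManolescu2019, §1, eq. (1)]; the «RECTANGLE COEFFICIENT» line of the venture lane «pcv-sawmu»
(b-engine-1 g27). The hole root in the `W`-normalisation (root on the `W` side of the root plaquette `w`, hole `(w.1 − 1, w.2)`) lies ON the axis of the row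
reflection `ρ : (x, y) ↦ (x, 2·w.2 − y)`, which fixes the root mid-edge and the hole; by the mirror covariance of the printed vertex functional
(`PlaquetteWalkMirrorDuality.vertexFunctional_printed_map_mirrorRow_eq_zero_iff`: `VF_θ(ρDl; ρa; ρf₀) = 0 ↔ VF_{π−θ}(Dl; a; f₀) = 0`) the zero set of
`VF_D(w.side W, f₀; ·)` in `(0, π)` is the image under `θ ↦ π − θ` of the zero set of `VF_{ρD}(w.side W, ρf₀; ·)` (§1, ★★★
`vertexFunctional_printed_zero_set_eq_image_mirrorRow`; so finiteness, the cardinality bound and «not identically zero» pass from the reflected configuration to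
the configuration). §2 reflects the closed column law ABOVE the root row (`PlaquetteWalkHoleRootColumnLawWitness`, cells `(w.1 + k, w.2 + y)`, `k ≤ 1`,
`1 ≤ y ≤ 2`) to the cells `(w.1 + k, w.2 − y)` BELOW it: ★★★★★ `vertexFunctional_printed_exists_ne_zero_of_colBlock_below` — for EVERY finite face list
`Dl` missing the hole and containing the reflected block `(colBlock w k y).map ρ`, the printed vertex functional at `(w.1 + k, w.2 − y)` is NOT identically
zero on `(0, π)`, with at most `4·maxExp(ρDl) − 4` zeros — no walk-level analysis below the row is needed. [GlazmanManolescu2019 §1 eq. (1) and the remark after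
it (θ ↔ π − θ exchanges u₁ ↔ u₂, w₁ ↔ w₂), Lemma 2.1 (eq. (CR)), Remark 2.2, §4.2 (lattice symmetries); Glazman2015WeightedSAW Lemma 3.1 (proof, pp. 6–7)]
-/

noncomputable section

open Set Function Complex

namespace Literature.Barriers.CriticalPhenomena.PlaquetteWalk

open Literature.Probability.RandomPlanarGeometry.SAW.YangBaxter
open Real Complex

variable {Dl : List Face} {w : Face}

/-! ## §1 The zero set of the vertex functional at a `W`-rooted hole is the mirror image of the reflected configuration's -/

/-- The domain of the reflected list is the reflected domain. [cite: GlazmanManolescu2019, §4.2 (lattice symmetries)] -/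
theorem dom_map_mirrorRowFace_eq_rowMirrorDom (w : Face) (Dl : List Face) : dom (Dl.map (mirrorRowFace w.2)) = rowMirrorDom w (dom Dl) := by
  ext g; rw [mem_dom_map_mirrorRowFace, mem_rowMirrorDom]

/-- The hole of a `W`-rooted hole root lies on the axis: the reflected list misses it too. [cite: GlazmanManolescu2019, §4.2 (lattice symmetries)] -/
theorem holeFaceW_not_mem_dom_map_mirrorRowFace (hh : holeFaceW w ∉ dom Dl) : holeFaceW w ∉ dom (Dl.map (mirrorRowFace w.2)) := by
  rw [mem_dom_map_mirrorRowFace]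
  have e : mirrorRowFace w.2 (holeFaceW w) = holeFaceW w := by
    obtain ⟨a, b⟩ := w; simp only [mirrorRowFace, holeFaceW]; exact Prod.ext rfl (by ring)
  rwa [e]

/-- A rhombus rooted at `w.side W` reflects to a rhombus rooted at `w.side W` in the reflected list. [cite: GlazmanManolescu2019, §2.1 (walks start on the boundary), §4.2] -/
theorem rootedFace_map_mirrorRowFace {f₀ : Face} (hr : RootedFace (dom Dl) (w.side .W) f₀) :
    RootedFace (dom (Dl.map (mirrorRowFace w.2))) (w.side .W) (mirrorRowFace w.2 f₀) := by
  rw [dom_map_mirrorRowFace_eq_rowMirrorDom]; exact ΩG.rootedFace_rowMirrorDom_mirrorRowFace hr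

/-- ★★★ **THE ZERO SET IS THE MIRROR IMAGE OF THE REFLECTED CONFIGURATION'S.** For a root on the `W` side of `w` (a mid-edge of the axis row `w.2`), the zeros in
`(0, π)` of the printed vertex functional of `Dl` at `f₀` are the images under `θ ↦ π − θ` of the zeros of the printed vertex functional of the reflected list
`ρDl` at the reflected rhombus `ρf₀`. [cite: GlazmanManolescu2019, Lemma 2.1, eq. (CR); §1, eq. (1) and the remark after it (θ ↔ π − θ); §4.2 (lattice symmetries)] -/
theorem vertexFunctional_printed_zero_set_eq_image_mirrorRow (Dl : List Face) (w f₀ : Face) :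
    {θ ∈ Set.Ioo 0 π | vertexFunctional (printedWeights θ) tFiveEighths (ybCoeff θ) Dl (w.side .W) f₀ = 0} =
      (fun θ => π - θ) '' {θ ∈ Set.Ioo 0 π | vertexFunctional (printedWeights θ) tFiveEighths (ybCoeff θ) (Dl.map (mirrorRowFace w.2)) (w.side .W)
        (mirrorRowFace w.2 f₀) = 0} := by
  ext θ
  simp only [Set.mem_setOf_eq, Set.mem_image, Set.mem_Ioo]
  constructor
  · rintro ⟨hθ, h0⟩
    refine ⟨π - θ, ⟨⟨by linarith [hθ.2], by linarith [hθ.1]⟩, ?_⟩, sub_sub_cancel π θ⟩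
    have key := vertexFunctional_printed_map_mirrorRow_eq_zero_iff θ w.2 (Dl.map (mirrorRowFace w.2)) (w.side .W) (mirrorRowFace w.2 f₀)
    rw [map_mirrorRowFace_map_mirrorRowFace, mirrorRowFace_mirrorRowFace, mirrorRow_root w] at key
    exact key.1 h0
  · rintro ⟨θ', ⟨hθ', h0⟩, rfl⟩
    refine ⟨⟨by linarith [hθ'.2], by linarith [hθ'.1]⟩, ?_⟩
    have key := vertexFunctional_printed_map_mirrorRow_eq_zero_iff (π - θ') w.2 (Dl.map (mirrorRowFace w.2)) (w.side .W) (mirrorRowFace w.2 f₀)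
    rw [map_mirrorRowFace_map_mirrorRowFace, mirrorRowFace_mirrorRowFace, mirrorRow_root w, sub_sub_cancel] at key
    exact key.2 h0

/-- ★★★ **FINITE ZERO SETS REFLECT**: a finite zero set with a cardinality bound for the reflected configuration gives the same for the configuration.
[cite: GlazmanManolescu2019, Lemma 2.1, eq. (CR); §4.2 (lattice symmetries)] -/
theorem vertexFunctional_printed_zero_set_finite_of_mirrorRow {f₀ : Face} {N : ℕ}
    (h : {θ ∈ Set.Ioo 0 π | vertexFunctional (printedWeights θ) tFiveEighths (ybCoeff θ) (Dl.map (mirrorRowFace w.2)) (w.side .W)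
        (mirrorRowFace w.2 f₀) = 0}.Finite ∧
      {θ ∈ Set.Ioo 0 π | vertexFunctional (printedWeights θ) tFiveEighths (ybCoeff θ) (Dl.map (mirrorRowFace w.2)) (w.side .W)
        (mirrorRowFace w.2 f₀) = 0}.ncard ≤ N) :
    {θ ∈ Set.Ioo 0 π | vertexFunctional (printedWeights θ) tFiveEighths (ybCoeff θ) Dl (w.side .W) f₀ = 0}.Finite ∧
      {θ ∈ Set.Ioo 0 π | vertexFunctional (printedWeights θ) tFiveEighths (ybCoeff θ) Dl (w.side .W) f₀ = 0}.ncard ≤ N := by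
  rw [vertexFunctional_printed_zero_set_eq_image_mirrorRow Dl w f₀]
  refine ⟨h.1.image _, ?_⟩
  rw [Set.ncard_image_of_injective _ (sub_right_injective (G := ℝ))]
  exact h.2

/-- ★★★ **«NOT IDENTICALLY ZERO» REFLECTS**: if the reflected configuration's vertex functional is not identically zero on `(0, π)`, neither is the configuration's.
[cite: GlazmanManolescu2019, Lemma 2.1, eq. (CR); §4.2 (lattice symmetries)] -/
theorem vertexFunctional_printed_exists_ne_zero_of_mirrorRow {f₀ : Face}
    (h : ∃ θ ∈ Set.Ioo 0 π, vertexFunctional (printedWeights θ) tFiveEighths (ybCoeff θ) (Dl.map (mirrorRowFace w.2)) (w.side .W) (mirrorRowFace w.2 f₀) ≠ 0) :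
    ∃ θ ∈ Set.Ioo 0 π, vertexFunctional (printedWeights θ) tFiveEighths (ybCoeff θ) Dl (w.side .W) f₀ ≠ 0 := by
  obtain ⟨θ', hθ', hne⟩ := h
  refine ⟨π - θ', ⟨by linarith [hθ'.2], by linarith [hθ'.1]⟩, fun h0 => hne ?_⟩
  have key := vertexFunctional_printed_map_mirrorRow_eq_zero_iff (π - θ') w.2 (Dl.map (mirrorRowFace w.2)) (w.side .W) (mirrorRowFace w.2 f₀)
  rw [map_mirrorRowFace_map_mirrorRowFace, mirrorRowFace_mirrorRowFace, mirrorRow_root w, sub_sub_cancel] at key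
  exact key.1 h0

/-! ## §2 The column law BELOW the root row: the reflected column witnesses -/

/-- The reflection carries `(w.1 + k, w.2 − y)` to `(w.1 + k, w.2 + y)`. [cite: GlazmanManolescu2019, §4.2 (lattice symmetries)] -/
theorem mirrorRowFace_below (w : Face) (k y : ℤ) : mirrorRowFace w.2 ((w.1 + k, w.2 - y) : Face) = (w.1 + k, w.2 + y) := by
  simp only [mirrorRowFace]; exact Prod.ext rfl (by ring)

/-- The block above the row lies in the reflected list when the reflected block lies in the list. [cite: GlazmanManolescu2019, §4.2 (lattice symmetries)] -/
theorem colBlock_mem_map_mirrorRowFace {k y : ℕ} (hB : ∀ c ∈ (colBlock w k y).map (mirrorRowFace w.2), c ∈ Dl) :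
    ∀ c ∈ colBlock w k y, c ∈ Dl.map (mirrorRowFace w.2) := fun c hc =>
  List.mem_map.2 ⟨mirrorRowFace w.2 c, hB _ (List.mem_map.2 ⟨c, hc, rfl⟩), mirrorRowFace_mirrorRowFace _ _⟩

/-- ★★★★★ **THE COLUMN LAW BELOW THE ROOT ROW, CLOSED FORM.** For every finite face list `Dl` missing the hole `(w.1 − 1, w.2)` and containing the reflected block
`(colBlock w k y).map ρ` (`k ≤ 1`, `1 ≤ y ≤ 2`; the boundary of `[w.1 − 2, w.1 + k + 2] × [w.2 − y, w.2 + 1]` with the root-row segment and the column of the cell),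
the printed Yang–Baxter vertex functional at the root `w.side W` and the rhombus `(w.1 + k, w.2 − y)` BELOW the root row has finitely many zeros in `(0, π)`, at
most `4·maxExp(ρDl, w.side W, (w.1 + k, w.2 + y)) − 4`. [cite: GlazmanManolescu2019, Lemma 2.1 and eq. (1); Remark 2.2; §4.2 (lattice symmetries)]
[cite: Glazman2015WeightedSAW, Lemma 3.1 (proof, pp. 6–7)] -/
theorem vertexFunctional_printed_zero_set_finite_of_colBlock_below {k y : ℕ} (hk : k ≤ 1) (hy1 : 1 ≤ y) (hy2 : y ≤ 2) (hh : holeFaceW w ∉ dom Dl)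
    (hB : ∀ c ∈ (colBlock w k y).map (mirrorRowFace w.2), c ∈ Dl) (hr : RootedFace (dom Dl) (w.side .W) (w.1 + k, w.2 - y)) :
    {θ ∈ Set.Ioo 0 π | vertexFunctional (printedWeights θ) tFiveEighths (ybCoeff θ) Dl (w.side .W) (w.1 + k, w.2 - y) = 0}.Finite ∧
      {θ ∈ Set.Ioo 0 π | vertexFunctional (printedWeights θ) tFiveEighths (ybCoeff θ) Dl (w.side .W) (w.1 + k, w.2 - y) = 0}.ncard ≤
        4 * maxExp (Dl.map (mirrorRowFace w.2)) (w.side .W) (w.1 + k, w.2 + y) + 1 - 5 := by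
  have e := mirrorRowFace_below w k y
  have hr' := rootedFace_map_mirrorRowFace hr
  rw [e] at hr'
  have h := vertexFunctional_printed_zero_set_finite_of_colBlock hk hy1 hy2 (holeFaceW_not_mem_dom_map_mirrorRowFace hh)
    (colBlock_mem_map_mirrorRowFace hB) hr'
  refine vertexFunctional_printed_zero_set_finite_of_mirrorRow ?_
  rw [e]; exact h

/-- ★★★★★ **NOT IDENTICALLY ZERO BELOW THE ROOT ROW, CLOSED FORM**: under the same hypotheses some `θ ∈ (0, π)` has `VF_D(w.side W, (w.1 + k, w.2 − y); θ) ≠ 0`.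
[cite: GlazmanManolescu2019, Lemma 2.1 and eq. (1); Remark 2.2; §4.2 (lattice symmetries)] [cite: Glazman2015WeightedSAW, Lemma 3.1 (proof, pp. 6–7)] -/
theorem vertexFunctional_printed_exists_ne_zero_of_colBlock_below {k y : ℕ} (hk : k ≤ 1) (hy1 : 1 ≤ y) (hy2 : y ≤ 2) (hh : holeFaceW w ∉ dom Dl)
    (hB : ∀ c ∈ (colBlock w k y).map (mirrorRowFace w.2), c ∈ Dl) (hr : RootedFace (dom Dl) (w.side .W) (w.1 + k, w.2 - y)) :
    ∃ θ ∈ Set.Ioo 0 π, vertexFunctional (printedWeights θ) tFiveEighths (ybCoeff θ) Dl (w.side .W) (w.1 + k, w.2 - y) ≠ 0 := by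
  have e := mirrorRowFace_below w k y
  have hr' := rootedFace_map_mirrorRowFace hr
  rw [e] at hr'
  have h := vertexFunctional_printed_exists_ne_zero_of_colBlock hk hy1 hy2 (holeFaceW_not_mem_dom_map_mirrorRowFace hh)
    (colBlock_mem_map_mirrorRowFace hB) hr'
  refine vertexFunctional_printed_exists_ne_zero_of_mirrorRow ?_
  rw [e]; exact h

end Literature.Barriers.CriticalPhenomena.PlaquetteWalk
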